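import Summits.QuantumFields.BalabanUV.T4Continuum.Support.MinimalActionSandwich
import Literature.MathematicalPhysics.QuantumFieldTheory.Balaban1983to89.T4EtaRateMin
import HarnessLib

/-!
# T⁴ programme, node NE3 (η-rate of the minimisers) — THE ACTION SANDWICH, part 3: the ACTION-VALUE η-RATE
# `T4EtaRateMin.ActionRate` (rate `L^{−2}`) from minimisers with printed-TYPE regularity, and the small-field class

Sixteenth generation of the NE3 prover lineage P1 of the cell `pub-balaban` (unit `b2b-balaban-t4-ne3-p1`, OWNER of
`BINDER-OWNERS.md` row NE3), file 3 of the «action sandwich» series (part 1 `MinimalActionLevels`: level actions, the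
composition law (43), the deficit identity, class transport; part 2 `MinimalActionSandwich`: admissible sets, `minAct`,
the two-competitor sandwich, the periodic value wall β′-per of row NE3-R2 plugged in BY NAME).

## The theorem (all [folklore] bookkeeping over the tree's objects; the wall is row NE3-R2's theorem)

`Regular L N b g j U` («printed-TYPE regularity of a level-`j` competitor», §1): `U` is `U(N)`-valued, `(N·L^j)`-periodic
(a configuration on the torus of side `N` at spacing `L^{−j}`, read on `ℤ^d`), in the small-field class with radius
`b·(L^j)^{−2}` (B11 (2)/(8): `|U(∂p) − 1| < B₃ε₁η²`), and its flux has covariant-gradient energy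
`‖∇_U F‖²_{ℓ²(period)} ≤ g·N^d·(L^j)^{d−6}` (the `ℓ²` form of «`|∇_U F| ≲ ε₁η³` pointwise» — B11 (9)ˢᵘᵖ + (10) read in `ℓ²`
through interior `H²`, record `t4/T4-EST-NE3-P2.md` (3.8); NOT derived here).  `SandwichData 𝒞 L N b g V` (§2) asks,
for the datum `V` and EVERY level `k`: (H1) a minimiser of run `k` exists; (H3) every minimiser of run `k+1` is
`Regular … (k+1)`; (H4) its rescaled one-step average lies in the class `𝒞 k`; (H2) every minimiser of run `k` is the
rescaled one-step average of SOME `Regular … (k+1)` configuration of class `𝒞 (k+1)` (a regular refinement).  THEN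
(**`abs_minAct_sub_le_rate`**, **`actionRate_of_sandwichData`**, §3): for `L, N ≥ 1`, `0 ≤ b`, `512(d+1)(d+4)L²b ≤ 1`,
  `|A_k(V) − A_{k+1}(V)| ≤ [wallConstNA(d,L)·(g + b³)/L²] · (L^{−2})^k · N^d`   for every `k`,
i.e. `ActionRate (minActReadings 𝒞 L N dom loc) (wallConstNA(d,L)(g + b³)/L²) (L^{−2})` on any `dom` on which
`SandwichData` holds and for ANY supplied local reading `loc` (a parameter with no default, so that nothing about the LOCAL
half is inhabited here) — the ACTION half of the node's shape `T4EtaRateMin.NE3Shape` with rate `θ = L^{−2}` and the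
volume factor `N^d`
(`vol = |T₁|`), constants depending on `d, L` (through row NE3-R2's `wallConstNA`) and on the regularity data `b, g` only.
§4 instantiates the class: `sfClass L N ε k` = `U(N)`-valued, `(N·L^k)`-periodic, `SmallField · (ε·(L^k)^{−2})` (B11's
space (6) in the everywhere-small-field case, plaquette condition of (2)); for it (H4) is a THEOREM
(`rescale_bavg_mem_sfClass`: B7 Prop. 1 (51) = tree `prop1_explicit`, whenever `b + 226(8(d+1)(d+4))²b² ≤ ε`), so
`SandwichData` reduces to (H1) existence, (H3) regularity, (H2) regular refinement (`sandwichData_sfClass`).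

## What this changes for NE3 (record `t4/T4-EST-U1b-OSC.md` v1.34 §4¹⁸; `t4/T4-EST-NE3-P1.md` v2.33)

For the ACTION reading (A) of NE3 the list of unprinted inputs is EMPTY: no derivative wall β, no tangent coercivity
ML, no fine criticality R0, no lift (γ), no localisation δ (energy route, `t4/T4-EST-NE3-P2.md` §0 (e)), no stability
(W1) or consistency (W2) reading (print route, `SliceCovariantLevels` p199789).  What remains is printed TYPE, asserted
NOWHERE here: (H1)+(H3) = B11 Theorem 1 at level `k+1` — existence of the minimal orbit in the space (8) ⊂ (6) and the
regularity (9)ˢᵘᵖ/(10) (plus the folklore interior-`H²` step to the `ℓ²` gradient of the flux); (H2): EXISTENCE and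
the small-field RADIUS of a refinement with exact one-step average = B11 Theorem 1 for ONE step with datum `U_k(V)`
rescaled to the unit lattice (`ε₁′ = B₃ε₁η² ≤ a₁`; radius `B₃ε₁′L^{−2}`) — but its GRADIENT clause at the finer scale is
NOT an instance of that one-step problem's (9)–(10) (which see only the datum's plaquette size `ε₁′`, not its slow
variation over `L^k` lattice units, and so lose a factor `L^{−k}`): it is the ONE-STEP RESPONSE reading — Lipschitz
dependence of the one-step minimiser on its datum (the scheme (116)–(121)/Prop. 6 of B11 §E and the analyticity Prop. 9
p. 309, kernel-typed over abstract carriers in `T4FixedPointResponse` §4 `norm_solution_sub_le_data`) × translation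
covariance × the level-`k` gradient regularity of `U_k(V)` itself — printed TYPE one dictionary step deeper, and the one
place where this lineage's implicit-function technique re-enters; `Regular.mono` lets the refinement's (larger) constants
and the minimiser's share one pair `(b, g)`; (H4) = B7 Prop. 1 (kernel, §4).  The LOCAL readings (D)/(F) of NE3 are
untouched (their walls δ ∕ (W2) stand).

HONEST FRAMING.  Finite-T⁴ ultraviolet bookkeeping about MINIMISERS (rung (B)+1 of the cell's ladder); the only
estimate used is row NE3-R2's PROVED `abs_deficit_torus_le`; no conditional of the cell (`BetaPertH`, (B), (B^μ)) is
used or hidden; nothing bears on infinite volume, a mass gap, or the Clay problem; **NE3 is NOT proved** (H1–H3 are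
hypotheses; their discharge is B11 Thm 1, a theorem of the manuscript under audit, never cited as a fact here).
ABSOLUTE RULE of the cell kept: no printed sentence is a hypothesis of any declaration — `Regular`/`SandwichData` are
SHAPES over abstract data, consumed towards the node's shape only; no `sorry`, no axioms beyond Mathlib's.  PLACEMENT
(human rule 2026-08-19): cell work under `Summits/QuantumFields/BalabanUV/`; imports `Support.MinimalActionSandwich` only;
moves nothing.  Records: `t4/T4-EST-U1b-OSC.md` v1.34, `t4/T4-EST-NE3-P1.md` v2.33, GAPS G-ne3p1-46 of the cell `pub-balaban`.
-/

set_option autoImplicit false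

open scoped BigOperators Matrix Matrix.Norms.L2Operator
open NormedSpace Finset

namespace Summit.QuantumFields.BalabanUV.T4Continuum.MinimalActionRate

open Literature.MathematicalPhysics.QuantumFieldTheory.Balaban1983to89
open B7Prop1Explicit B7Prop2Explicit MatrixLog UnitaryModel
open T4AveragingDeficitWall hiding Site Plane Plaq Bond
open T4AveragingDeficitWallBoundary (IsPeriodicCfg periodBox blockSites_periodBox mem_periodBox card_periodBox)
open T4AveragingDeficitNonAbelian (wallConstNA wallConstNA_nonneg abs_deficit_torus_le)
open T4EtaRateMin (Readings ActionRate)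
open MinimalActionLevels MinimalActionSandwich

noncomputable section

variable {d : ℕ} {n : Type*} [Fintype n] [DecidableEq n]

local notation "𝕄" => Matrix n n ℂ
local notation "Site" => B7Prop1Explicit.Site

/-! ## §1 Printed-TYPE regularity of a level-`j` competitor -/

variable (d) in
/-- **REGULARITY OF A LEVEL-`j` COMPETITOR** (a SHAPE; dictionary: B11 Thm 1 (8)–(10) for a minimal configuration at
spacing `η = L^{−j}` on the torus of side `N`, read on `ℤ^d`): `U(N)`-valued; `(N·L^j)`-periodic; small field of radius
`b·(L^j)^{−2}` («`|U(∂p) − 1| < B₃ε₁η²`», (2)/(8)); flux covariant-gradient energy over one period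
`≤ g·N^d·(L^j)^d/(L^j)^6` (the `ℓ²` form of «`|∇_U F| ≲ ε₁η³`», (9)ˢᵘᵖ + (10) via interior `H²`).  Asserted for no
configuration here; a hypothesis SHAPE of ours, not a printed statement (context: [Balaban1985Variational] Thm 1 (8)–(10)
p. 279). [folklore] -/
@[folklore]
structure Regular (L N : ℕ) (b g : ℝ) (j : ℕ) (U : Site d → Fin d → 𝕄ˣ) : Prop where
  /-- `U(N)`-valued -/
  unitary : IsUnitaryCfg U
  /-- a configuration on the torus of side `N` at spacing `L^{−j}` -/
  periodic : IsPeriodicCfg U ((N * L ^ j : ℕ) : ℤ)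
  /-- small field of radius `b η²`, `η = L^{−j}` -/
  small : SmallField U (b / ((L : ℝ) ^ j) ^ 2)
  /-- `‖∇_U F‖²_{ℓ²(period)} ≤ g N^d η^{6−d}` -/
  grad : gradFluxSq U (periodBox (N * L ^ j)) ≤ g * (N : ℝ) ^ d * ((L : ℝ) ^ j) ^ d / ((L : ℝ) ^ j) ^ 6

/-- `Regular` is monotone in the regularity data `(b, g)` (so minimisers and refinements with different printed
constants fit ONE pair: take the larger). [folklore] -/
theorem Regular.mono {L N j : ℕ} {b g b' g' : ℝ} {U : Site d → Fin d → 𝕄ˣ} (h : Regular d L N b g j U)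
    (hb : b ≤ b') (hg : g ≤ g') : Regular d L N b' g' j U where
  unitary := h.unitary
  periodic := h.periodic
  small := fun x κ κ' hκ => (h.small x κ κ' hκ).trans (div_le_div_of_nonneg_right hb (by positivity))
  grad := h.grad.trans (div_le_div_of_nonneg_right
    (mul_le_mul_of_nonneg_right (mul_le_mul_of_nonneg_right hg (by positivity)) (by positivity)) (by positivity))

/-- `ℓ²` from `sup`: a pointwise bound `c` on the covariant gradient of the flux gives
`gradFluxSq U ([0,P)^d) ≤ P^d · (d · #Plane d) · c²`. [folklore] -/
theorem gradFluxSq_le_of_sup {U : Site d → Fin d → 𝕄ˣ} (P : ℕ) {c : ℝ}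
    (h : ∀ (x : Site d) (κ : Fin d) (π : T4AveragingDeficitWall.Plane d), ‖covGrad U (flux U) x κ π‖ ≤ c) :
    gradFluxSq U (periodBox P) ≤ (P : ℝ) ^ d * (d * Fintype.card (T4AveragingDeficitWall.Plane d)) * c ^ 2 := by
  unfold gradFluxSq
  have hpt : ∀ x ∈ periodBox (d := d) P,
      ∑ κ : Fin d, ∑ π : T4AveragingDeficitWall.Plane d, ‖covGrad U (flux U) x κ π‖ ^ 2
        ≤ (d * Fintype.card (T4AveragingDeficitWall.Plane d)) * c ^ 2 := by
    intro x _
    calc ∑ κ : Fin d, ∑ π : T4AveragingDeficitWall.Plane d, ‖covGrad U (flux U) x κ π‖ ^ 2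
        ≤ ∑ _κ : Fin d, ∑ _π : T4AveragingDeficitWall.Plane d, c ^ 2 :=
          Finset.sum_le_sum fun κ _ => Finset.sum_le_sum fun π _ =>
            pow_le_pow_left₀ (norm_nonneg _) (h x κ π) 2
      _ = (d * Fintype.card (T4AveragingDeficitWall.Plane d)) * c ^ 2 := by
          simp only [Finset.sum_const, Finset.card_univ, Fintype.card_fin, nsmul_eq_mul]; ring
  refine (Finset.sum_le_sum hpt).trans ?_
  rw [Finset.sum_const, card_periodBox, nsmul_eq_mul]
  push_cast
  exact le_of_eq (by ring)

/-- **`Regular` FROM POINTWISE BOUNDS** — the printed TYPE literally: `U(N)`-valued, `(N·L^j)`-periodic,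
`|U(∂p) − 1| ≤ b η²` and `|∇_U F| ≤ ϱ η³` pointwise (`η = L^{−j}`) give `Regular d L N b (d·#Plane d·ϱ²) j U`
(the `ℓ²` gradient bound by counting the `(N L^j)^d` sites of one period). [folklore] -/
theorem regular_of_sup {L N j : ℕ} {b ϱ : ℝ} {U : Site d → Fin d → 𝕄ˣ} (hu : IsUnitaryCfg U)
    (hp : IsPeriodicCfg U ((N * L ^ j : ℕ) : ℤ)) (hs : SmallField U (b / ((L : ℝ) ^ j) ^ 2))
    (hsup : ∀ (x : Site d) (κ : Fin d) (π : T4AveragingDeficitWall.Plane d),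
      ‖covGrad U (flux U) x κ π‖ ≤ ϱ / ((L : ℝ) ^ j) ^ 3) :
    Regular d L N b (d * Fintype.card (T4AveragingDeficitWall.Plane d) * ϱ ^ 2) j U where
  unitary := hu
  periodic := hp
  small := hs
  grad := by
    refine (gradFluxSq_le_of_sup (N * L ^ j) hsup).trans (le_of_eq ?_)
    push_cast
    rw [mul_pow, div_pow, ← pow_mul]
    ring

/-! ## §2 The hypotheses of the sandwich at every level -/

variable (d) in
/-- **THE SANDWICH DATA of a datum `V`** (a SHAPE, asserted for no datum here): for every level `k`,
(H1) `exists_minimiser` — run `k` has a minimiser (B11 Thm 1, existence);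
(H3) `regular` — every minimiser of run `k+1` is `Regular … (k+1)` (B11 Thm 1 (8)–(10));
(H4) `avg_mem` — its rescaled one-step average lies in the class `𝒞 k` (B7 Prop. 1; a THEOREM for the small-field
class, §4);
(H2) `refine` — every minimiser of run `k` is the rescaled one-step average of some `Regular … (k+1)` configuration of
class `𝒞 (k+1)` (existence + radius: B11 Thm 1 for ONE step with the minimiser as datum, cf. (11)–(13); gradient clause:
the one-step response × covariance reading of the module header).  A hypothesis SHAPE of ours, not a printed statement
(context: [Balaban1985Variational] Thm 1 p. 279, (11)–(13) pp. 279–280, (116)–(121) p. 295). [folklore] -/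
@[folklore]
structure SandwichData (𝒞 : ℕ → Set (Site d → Fin d → 𝕄ˣ)) (L N : ℕ) (b g : ℝ) (V : Site d → Fin d → 𝕄ˣ) :
    Prop where
  /-- (H1) existence of a minimiser of every run -/
  exists_minimiser : ∀ k : ℕ, ∃ U, IsMinimiser d 𝒞 L N k V U
  /-- (H3) regularity of the minimisers -/
  regular : ∀ (k : ℕ) (U : Site d → Fin d → 𝕄ˣ), IsMinimiser d 𝒞 L N (k + 1) V U → Regular d L N b g (k + 1) U
  /-- (H4) the averaged finer minimiser lies in the coarser class -/
  avg_mem : ∀ (k : ℕ) (U : Site d → Fin d → 𝕄ˣ), IsMinimiser d 𝒞 L N (k + 1) V U → rescale L (bavg L U) ∈ 𝒞 k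
  /-- (H2) a regular refinement of the coarser minimiser exists -/
  refine : ∀ (k : ℕ) (U : Site d → Fin d → 𝕄ˣ), IsMinimiser d 𝒞 L N k V U →
    ∃ Ut, Ut ∈ 𝒞 (k + 1) ∧ rescale L (bavg L Ut) = U ∧ Regular d L N b g (k + 1) Ut

/-! ## §3 The action-value η-rate -/

/-- The scaling algebra of the rate: `(L^4/L^d)^{k+1} · W · (g + b³)N^d (L^{k+1})^d/(L^{k+1})^6
= W(g + b³)/L² · (L^{−2})^k · N^d`. [folklore] -/
theorem rate_algebra {x W g b N : ℝ} (hx : x ≠ 0) (k : ℕ) :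
    (x ^ 4 / x ^ d) ^ (k + 1) * (W * ((g + b ^ 3) * N ^ d * (x ^ (k + 1)) ^ d / (x ^ (k + 1)) ^ 6))
      = W * (g + b ^ 3) / x ^ 2 * ((x ^ 2)⁻¹) ^ k * N ^ d := by
  have h1 : ((x ^ 2)⁻¹) ^ k = 1 / x ^ (2 * k) := by rw [inv_pow, ← pow_mul, one_div]
  rw [h1, div_pow]
  field_simp
  ring

/-- The inverse of the printed weight: `(L^{d−4})⁻¹ = L^4/L^d` (`L ≥ 1`). [folklore] -/
theorem stepWt_inv_eq (L : ℕ) (hL : 1 ≤ L) : (stepWt d L)⁻¹ = (L : ℝ) ^ 4 / (L : ℝ) ^ d := by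
  have hL0 : (L : ℝ) ≠ 0 := by exact_mod_cast (by omega : L ≠ 0)
  unfold stepWt
  rw [zpow_sub₀ hL0, zpow_natCast, show (4 : ℤ) = ((4 : ℕ) : ℤ) by norm_num, zpow_natCast, inv_div]

/-- **THE PER-LEVEL RATE BOUND**: under `SandwichData`, for `L, N ≥ 1`, `0 ≤ b`, `512(d+1)(d+4)L²b ≤ 1` and every
`k`:  `|A_k(V) − A_{k+1}(V)| ≤ [wallConstNA(d,L)·(g + b³)/L²] · (L^{−2})^k · N^d`.
Proof: part 2's `abs_minAct_sub_minAct_le_wall` with the minimiser `U_B` of run `k+1` and the regular refinement `Ũ` of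
the minimiser `U_A` of run `k` as the two competitors (common radius `a = b(L^{k+1})^{−2}`, common gradient bound
`G = gN^d(L^{k+1})^{d−6}`; `a³(NL^k)^d ≤ b³N^d(L^{k+1})^{d−6}`), then `rate_algebra`. [folklore] -/
theorem abs_minAct_sub_le_rate [Nonempty n] {𝒞 : ℕ → Set (Site d → Fin d → 𝕄ˣ)} {L N : ℕ} (hL : 1 ≤ L)
    (hN : 1 ≤ N) {b g : ℝ} (hb : 0 ≤ b) (hbs : 512 * (d + 1) * (d + 4) * (L : ℝ) ^ 2 * b ≤ 1)
    {V : Site d → Fin d → 𝕄ˣ} (h : SandwichData d 𝒞 L N b g V) (k : ℕ) :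
    |minAct d 𝒞 L N k V - minAct d 𝒞 L N (k + 1) V|
      ≤ wallConstNA d L * (g + b ^ 3) / (L : ℝ) ^ 2 * (((L : ℝ) ^ 2)⁻¹) ^ k * (N : ℝ) ^ d := by
  obtain ⟨UA, hA⟩ := h.exists_minimiser k
  obtain ⟨UB, hB⟩ := h.exists_minimiser (k + 1)
  obtain ⟨Ut, hUt𝒞, havg, hTreg⟩ := h.refine k UA hA
  have hBreg := h.regular k UB hB
  have hW := h.avg_mem k UB hB
  -- the common scale `s = L^{k+1} ≥ 1`
  have hL0 : (0 : ℝ) < L := by exact_mod_cast (by omega : 0 < L)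
  have hL1 : (1 : ℝ) ≤ L := by exact_mod_cast hL
  set s : ℝ := (L : ℝ) ^ (k + 1) with hsdef
  have hs1 : 1 ≤ s := one_le_pow₀ hL1
  have hs0 : 0 < s := by linarith
  have hs2 : 1 ≤ s ^ 2 := one_le_pow₀ hs1
  -- the common small-field radius `a = b/s²` and its threshold
  set a : ℝ := b / s ^ 2 with hadef
  have ha : 0 ≤ a := div_nonneg hb (by positivity)
  have hab : a ≤ b := div_le_self hb hs2
  have hsmall : 512 * (d + 1) * (d + 4) * (L : ℝ) ^ 2 * a ≤ 1 := by
    have hc : 0 ≤ 512 * ((d : ℝ) + 1) * (d + 4) * (L : ℝ) ^ 2 := by positivity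
    nlinarith
  -- the common gradient bound
  set G : ℝ := g * (N : ℝ) ^ d * s ^ d / s ^ 6 with hGdef
  have hmain := abs_minAct_sub_minAct_le_wall hL hN hA hB hW hUt𝒞 havg hBreg.unitary hBreg.periodic hTreg.unitary
    hTreg.periodic ha hsmall hBreg.small hTreg.small hBreg.grad hTreg.grad
  -- `a³ (N L^k)^d ≤ b³ N^d s^d / s^6`
  have hNr : (0 : ℝ) ≤ (N : ℝ) ^ d := by positivity
  have hM : ((N * L ^ k : ℕ) : ℝ) ^ d ≤ (N : ℝ) ^ d * s ^ d := by
    push_cast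
    rw [mul_pow]
    refine mul_le_mul_of_nonneg_left ?_ hNr
    exact pow_le_pow_left₀ (by positivity) (pow_le_pow_right₀ hL1 (Nat.le_succ k)) d
  have ha3 : a ^ 3 * ((N * L ^ k : ℕ) : ℝ) ^ d ≤ b ^ 3 * (N : ℝ) ^ d * s ^ d / s ^ 6 := by
    have h1 : a ^ 3 = b ^ 3 / s ^ 6 := by rw [hadef, div_pow, ← pow_mul]
    rw [h1, div_mul_eq_mul_div, mul_assoc]
    exact div_le_div_of_nonneg_right (mul_le_mul_of_nonneg_left hM (pow_nonneg hb 3)) (by positivity)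
  have hsum : G + a ^ 3 * ((N * L ^ k : ℕ) : ℝ) ^ d ≤ (g + b ^ 3) * (N : ℝ) ^ d * s ^ d / s ^ 6 := by
    have : (g + b ^ 3) * (N : ℝ) ^ d * s ^ d / s ^ 6 = G + b ^ 3 * (N : ℝ) ^ d * s ^ d / s ^ 6 := by
      rw [hGdef]; ring
    rw [this]; linarith
  have hWc := wallConstNA_nonneg (d := d) L
  have hc : 0 ≤ ((stepWt d L)⁻¹) ^ (k + 1) := pow_nonneg (inv_nonneg.mpr (stepWt_pos (d := d) L hL).le) _
  have hstep : ((stepWt d L)⁻¹) ^ (k + 1) * (wallConstNA d L * (G + a ^ 3 * ((N * L ^ k : ℕ) : ℝ) ^ d))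
      ≤ ((stepWt d L)⁻¹) ^ (k + 1) * (wallConstNA d L * ((g + b ^ 3) * (N : ℝ) ^ d * s ^ d / s ^ 6)) :=
    mul_le_mul_of_nonneg_left (mul_le_mul_of_nonneg_left hsum hWc) hc
  refine (hmain.trans hstep).trans (le_of_eq ?_)
  rw [stepWt_inv_eq (d := d) L hL, hsdef]
  exact rate_algebra hL0.ne' k

variable (d) in
/-- **THE READINGS CARRIER OF THE MINIMAL ACTIONS** (`T4EtaRateMin.Readings`): data `V` (configurations of `ℤ^d`),
admissible data `dom`, `act k V = A_k(V)` = the minimal level-`k` action `minAct`, volume factor `vol = N^d = |T₁|`, and a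
local reading `loc` SUPPLIED BY THE CALLER (an explicit parameter with no default: this series proves the ACTION half of
NE3 only and must not let `LocalRate`/`NE3Shape` on this carrier be inhabited by a junk reading — the local half, readings
(D)/(F), is a separate obligation about whatever `loc` a consumer supplies). [folklore] -/
def minActReadings (𝒞 : ℕ → Set (Site d → Fin d → 𝕄ˣ)) (L N : ℕ) (dom : Set (Site d → Fin d → 𝕄ˣ)) {X : Type*}
    (loc : ℕ → (Site d → Fin d → 𝕄ˣ) → X → ℝ) : Readings (Site d → Fin d → 𝕄ˣ) X where
  dom := dom
  act := fun k V => minAct d 𝒞 L N k V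
  loc := loc
  vol := (N : ℝ) ^ d
  vol_nonneg := by positivity

/-- **NE3, ACTION HALF, FROM THE SANDWICH** — `T4EtaRateMin.ActionRate` BY NAME with rate `θ = L^{−2}`: if every datum of
`dom` carries `SandwichData` (minimisers exist at every level with printed-TYPE regularity, their averages stay in the
class, regular one-step refinements exist), then
`ActionRate (minActReadings 𝒞 L N dom loc) (wallConstNA(d,L)·(g + b³)/L²) (L^{−2})` for EVERY supplied local reading
`loc` (the action rate does not look at it), i.e. `|A_{k+1}(V) − A_k(V)| ≤ C·(L^{−2})^k·N^d` for all `k` and all `V ∈ dom`.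
NO β, ML, R0, γ, δ, (W1), (W2).  NE3 is NOT proved: `SandwichData` is the hypothesis (B11 Thm 1 TYPE), asserted nowhere,
and nothing is said about `LocalRate` of the supplied `loc`. [folklore] -/
theorem actionRate_of_sandwichData [Nonempty n] {𝒞 : ℕ → Set (Site d → Fin d → 𝕄ˣ)} {L N : ℕ} (hL : 1 ≤ L)
    (hN : 1 ≤ N) {b g : ℝ} (hb : 0 ≤ b) (hbs : 512 * (d + 1) * (d + 4) * (L : ℝ) ^ 2 * b ≤ 1)
    {dom : Set (Site d → Fin d → 𝕄ˣ)} (hdom : ∀ V ∈ dom, SandwichData d 𝒞 L N b g V)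
    {X : Type*} (loc : ℕ → (Site d → Fin d → 𝕄ˣ) → X → ℝ) :
    ActionRate (minActReadings d 𝒞 L N dom loc) (wallConstNA d L * (g + b ^ 3) / (L : ℝ) ^ 2) (((L : ℝ) ^ 2)⁻¹) := by
  intro k V hV
  show |minAct d 𝒞 L N (k + 1) V - minAct d 𝒞 L N k V|
    ≤ wallConstNA d L * (g + b ^ 3) / (L : ℝ) ^ 2 * (((L : ℝ) ^ 2)⁻¹) ^ k * (N : ℝ) ^ d
  rw [abs_sub_comm]
  exact abs_minAct_sub_le_rate hL hN hb hbs (hdom V hV) k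

/-- The rate is honest: `0 ≤ L^{−2} < 1` for `L ≥ 2` (the half of `NE3Shape` that is not about readings). [folklore] -/
theorem rate_lt_one {L : ℕ} (hL : 2 ≤ L) : 0 ≤ ((L : ℝ) ^ 2)⁻¹ ∧ ((L : ℝ) ^ 2)⁻¹ < 1 := by
  have hL2 : (2 : ℝ) ≤ L := by exact_mod_cast hL
  have h4 : (4 : ℝ) ≤ (L : ℝ) ^ 2 := by nlinarith
  refine ⟨by positivity, ?_⟩
  rw [inv_lt_one_iff₀]
  right; linarith

/-! ## §4 The small-field class: B11's space (6), for which (H4) is a theorem -/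

variable (d) in
/-- **THE SMALL-FIELD CLASS AT LEVEL `k`** (dictionary: B11's space (6) `𝔘_k({Ω_j = T}, ε₀)` in the
everywhere-small-field case, plaquette condition of (2): `|U(∂p) − 1| < ε₀η²`, `η = L^{−k}`; here `≤`, with `U(N)`-valued
`(N·L^k)`-periodic configurations). [cite: Balaban1985Variational, (2) p.278, (6) p.278] -/
def sfClass (L N : ℕ) (ε : ℝ) (k : ℕ) : Set (Site d → Fin d → 𝕄ˣ) :=
  {U | IsUnitaryCfg U ∧ IsPeriodicCfg U ((N * L ^ k : ℕ) : ℤ) ∧ SmallField U (ε / ((L : ℝ) ^ k) ^ 2)}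

/-- The small-field class is monotone in the radius. [folklore] -/
theorem SmallField.mono {U : Site d → Fin d → 𝕄ˣ} {a a' : ℝ} (h : SmallField U a) (haa' : a ≤ a') :
    SmallField U a' :=
  fun x κ κ' hκ => (h x κ κ' hκ).trans haa'

/-- One averaging step maps the radius `b(L^{k+1})^{−2}` into the radius `(b + 226(8(d+1)(d+4))²b²)(L^k)^{−2}`:
`avgRadius d L (b/(L^{k+1})²) ≤ (b + 226(8(d+1)(d+4))²b²)/(L^k)²`. [folklore] -/
theorem avgRadius_level_le (L : ℕ) (hL : 1 ≤ L) (b : ℝ) (k : ℕ) :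
    avgRadius d L (b / ((L : ℝ) ^ (k + 1)) ^ 2)
      ≤ (b + 226 * (8 * (d + 1) * (d + 4)) ^ 2 * b ^ 2) / ((L : ℝ) ^ k) ^ 2 := by
  have hL0 : (0 : ℝ) < L := by exact_mod_cast (by omega : 0 < L)
  have hL1 : (1 : ℝ) ≤ L := by exact_mod_cast hL
  set t : ℝ := (L : ℝ) ^ k with htdef
  have ht1 : 1 ≤ t := one_le_pow₀ hL1
  have ht0 : 0 < t := by linarith
  have hLt : (L : ℝ) ^ (k + 1) = t * L := by rw [htdef, pow_succ]
  -- `L² · b/(tL)² = b/t²` and `(8(d+1)(d+4)L² · b/(tL)²)² = (8(d+1)(d+4))² b²/t⁴ ≤ (8(d+1)(d+4))² b²/t²`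
  have h1 : (L : ℝ) ^ 2 * (b / (t * L) ^ 2) = b / t ^ 2 := by
    field_simp
  have h2 : (8 * ((d : ℝ) + 1) * (d + 4) * (L : ℝ) ^ 2 * (b / (t * L) ^ 2)) ^ 2
      = (8 * ((d : ℝ) + 1) * (d + 4)) ^ 2 * b ^ 2 / (t ^ 2 * t ^ 2) := by
    field_simp
  have h3 : (8 * ((d : ℝ) + 1) * (d + 4)) ^ 2 * b ^ 2 / (t ^ 2 * t ^ 2)
      ≤ (8 * ((d : ℝ) + 1) * (d + 4)) ^ 2 * b ^ 2 / t ^ 2 := by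
    have ht2 : 1 ≤ t ^ 2 := one_le_pow₀ ht1
    exact div_le_div_of_nonneg_left (by positivity) (by positivity) (le_mul_of_one_le_right (by positivity) ht2)
  unfold avgRadius
  rw [hLt]
  calc (L : ℝ) ^ 2 * (b / (t * L) ^ 2) + 226 * (8 * ((d : ℝ) + 1) * (d + 4) * (L : ℝ) ^ 2 * (b / (t * L) ^ 2)) ^ 2
      = b / t ^ 2 + 226 * ((8 * ((d : ℝ) + 1) * (d + 4)) ^ 2 * b ^ 2 / (t ^ 2 * t ^ 2)) := by rw [h1, h2]
    _ ≤ b / t ^ 2 + 226 * ((8 * ((d : ℝ) + 1) * (d + 4)) ^ 2 * b ^ 2 / t ^ 2) :=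
      add_le_add le_rfl (mul_le_mul_of_nonneg_left h3 (by norm_num : (0 : ℝ) ≤ 226))
    _ = (b + 226 * (8 * ((d : ℝ) + 1) * (d + 4)) ^ 2 * b ^ 2) / t ^ 2 := by ring

/-- **(H4) IS A THEOREM FOR THE SMALL-FIELD CLASS**: a `Regular … (k+1)` configuration averages (and rescales) into
`sfClass L N ε k` as soon as `512(d+1)(d+4)L²b ≤ 1` and `b + 226(8(d+1)(d+4))²b² ≤ ε` — B7 Prop. 1 (51) = the tree's
`prop1_explicit` (`MinimalActionLevels.smallField_rescale_bavg`) + periodicity + unitarity transport.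
[cite: Balaban1985Averaging, Prop. 1 (51) p.26] -/
theorem rescale_bavg_mem_sfClass [Nonempty n] {L N : ℕ} (hL : 1 ≤ L) {b g ε : ℝ} (hb : 0 ≤ b)
    (hbs : 512 * (d + 1) * (d + 4) * (L : ℝ) ^ 2 * b ≤ 1) (hbε : b + 226 * (8 * (d + 1) * (d + 4)) ^ 2 * b ^ 2 ≤ ε)
    {k : ℕ} {U : Site d → Fin d → 𝕄ˣ} (hU : Regular d L N b g (k + 1) U) :
    rescale L (bavg L U) ∈ sfClass d L N ε k := by
  have hL1 : (1 : ℝ) ≤ L := by exact_mod_cast hL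
  have hs2 : 1 ≤ ((L : ℝ) ^ (k + 1)) ^ 2 := one_le_pow₀ (one_le_pow₀ hL1)
  have ha : 0 ≤ b / ((L : ℝ) ^ (k + 1)) ^ 2 := div_nonneg hb (by positivity)
  have hsmall : 512 * (d + 1) * (d + 4) * (L : ℝ) ^ 2 * (b / ((L : ℝ) ^ (k + 1)) ^ 2) ≤ 1 := by
    have hab : b / ((L : ℝ) ^ (k + 1)) ^ 2 ≤ b := div_le_self hb hs2
    have hc : 0 ≤ 512 * ((d : ℝ) + 1) * (d + 4) * (L : ℝ) ^ 2 := by positivity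
    nlinarith
  refine ⟨isUnitaryCfg_rescale_bavg L hL hU.unitary ha hsmall hU.small, ?_, ?_⟩
  · refine isPeriodicCfg_rescale_bavg L ?_
    have : ((N * L ^ (k + 1) : ℕ) : ℤ) = (L : ℤ) * ((N * L ^ k : ℕ) : ℤ) := by push_cast; ring
    rw [← this]; exact hU.periodic
  · refine SmallField.mono (smallField_rescale_bavg L hL hU.unitary ha hsmall hU.small) ?_
    refine (avgRadius_level_le (d := d) L hL b k).trans ?_
    exact div_le_div_of_nonneg_right hbε (by positivity)

/-- **`SandwichData` FOR THE SMALL-FIELD CLASS REDUCES TO (H1), (H3), (H2)**: existence of minimisers, their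
regularity, and regular refinements — (H4) being `rescale_bavg_mem_sfClass`. [folklore] -/
theorem sandwichData_sfClass [Nonempty n] {L N : ℕ} (hL : 1 ≤ L) {b g ε : ℝ} (hb : 0 ≤ b)
    (hbs : 512 * (d + 1) * (d + 4) * (L : ℝ) ^ 2 * b ≤ 1) (hbε : b + 226 * (8 * (d + 1) * (d + 4)) ^ 2 * b ^ 2 ≤ ε)
    {V : Site d → Fin d → 𝕄ˣ}
    (h1 : ∀ k : ℕ, ∃ U, IsMinimiser d (sfClass d L N ε) L N k V U)
    (h3 : ∀ (k : ℕ) (U : Site d → Fin d → 𝕄ˣ),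
      IsMinimiser d (sfClass d L N ε) L N (k + 1) V U → Regular d L N b g (k + 1) U)
    (h2 : ∀ (k : ℕ) (U : Site d → Fin d → 𝕄ˣ), IsMinimiser d (sfClass d L N ε) L N k V U →
      ∃ Ut, Ut ∈ sfClass d L N ε (k + 1) ∧ rescale L (bavg L Ut) = U ∧ Regular d L N b g (k + 1) Ut) :
    SandwichData d (sfClass d L N ε) L N b g V where
  exists_minimiser := h1
  regular := h3
  avg_mem := fun k U hU => rescale_bavg_mem_sfClass hL hb hbs hbε (h3 k U hU)
  refine := h2

/-- **NE3, ACTION HALF, FOR THE SMALL-FIELD CLASS**: on the set of data `V` for which minimisers exist at every level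
with printed-TYPE regularity and regular refinements (B11 Thm 1 TYPE, (H1)–(H3)), the minimal actions obey
`ActionRate … (wallConstNA(d,L)(g + b³)/L²) (L^{−2})`. [folklore] -/
theorem actionRate_sfClass [Nonempty n] {L N : ℕ} (hL : 1 ≤ L) (hN : 1 ≤ N) {b g ε : ℝ} (hb : 0 ≤ b)
    (hbs : 512 * (d + 1) * (d + 4) * (L : ℝ) ^ 2 * b ≤ 1) (hbε : b + 226 * (8 * (d + 1) * (d + 4)) ^ 2 * b ^ 2 ≤ ε)
    {dom : Set (Site d → Fin d → 𝕄ˣ)}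
    (h1 : ∀ V ∈ dom, ∀ k : ℕ, ∃ U, IsMinimiser d (sfClass d L N ε) L N k V U)
    (h3 : ∀ V ∈ dom, ∀ (k : ℕ) (U : Site d → Fin d → 𝕄ˣ),
      IsMinimiser d (sfClass d L N ε) L N (k + 1) V U → Regular d L N b g (k + 1) U)
    (h2 : ∀ V ∈ dom, ∀ (k : ℕ) (U : Site d → Fin d → 𝕄ˣ), IsMinimiser d (sfClass d L N ε) L N k V U →
      ∃ Ut, Ut ∈ sfClass d L N ε (k + 1) ∧ rescale L (bavg L Ut) = U ∧ Regular d L N b g (k + 1) Ut)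
    {X : Type*} (loc : ℕ → (Site d → Fin d → 𝕄ˣ) → X → ℝ) :
    ActionRate (minActReadings d (sfClass d L N ε) L N dom loc) (wallConstNA d L * (g + b ^ 3) / (L : ℝ) ^ 2)
      (((L : ℝ) ^ 2)⁻¹) :=
  actionRate_of_sandwichData hL hN hb hbs (fun V hV =>
    sandwichData_sfClass hL hb hbs hbε (h1 V hV) (h3 V hV) (h2 V hV)) loc

end

end Summit.QuantumFields.BalabanUV.T4Continuum.MinimalActionRate
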